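import Summits.MatrixMultiplication.MatrixMultiplication.Theorems.SoloInformedStrataUnconditional
import Literature.Computability.AlgebraicComplexity.SupportRank
import Literature.Computability.AlgebraicComplexity.TensorRestrictionRank

/-!
# Level one of the s-rank door is shut: `R_s(T_cw,q) = R(T_cw,q)`, `R_s(T_cw,2) = 4`

Solo deliverable (informed mode), companion to the s-rank door (`SoloInformedSupportDoor`): the door
asks for cheap RE-WEIGHTINGS of the support of `T_cw,2^{⊗N}`.  At `N = 1` there are none: every
tensor with the support of `T_cw,q` is TORUS-EQUIVALENT to `T_cw,q` (the `3q` support characters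
admit a diagonal solution with square roots), hence has the same rank; so
`R_s(T_cw,q) = R(T_cw,q)` and `R_s(T_cw,2) = 4`.  This is the exact form, for `T_cw,q`, of
Cohn–Umans' remark that substitution lower bounds also bound s-rank (arXiv:1207.6528, p. 8); the
re-weightings of the door acquire moduli
only from level `N = 2` on.

* `tensorRestrictsTo_diagScale` — diagonal scaling is a restriction;
* `exists_diagScale_of_sameSupport_cwTensor` — same support as `T_cw,q` ⇒ a torus translate of it;
* `tensorRank_eq_of_sameSupport_cwTensor`, `supportRank_cwTensor`, `supportRank_cwTensor_two`.

## References
* H. Cohn, C. Umans, *Fast matrix multiplication using coherent configurations*, SODA 2013,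
  arXiv:1207.6528, §3 p. 8. [CohnUmans2013]
* A. Conner, F. Gesmundo, J. M. Landsberg, E. Ventura, *Rank and border rank of Kronecker powers
  of tensors and Strassen's laser method*, comput. complexity 31 (2022), eq. (1).
  [ConnerGesmundoLandsbergVentura2022]
-/

noncomputable section

open scoped BigOperators
open Finset

namespace Summit.MatrixMultiplication.MatrixMultiplication.Theorems.SupportRankDoor

open Literature.Computability.AlgebraicComplexity

universe u

section Scale

variable {K : Type u} [Field K] {ι κ μ : Type} [Fintype ι] [Fintype κ] [Fintype μ]
  [DecidableEq ι] [DecidableEq κ] [DecidableEq μ]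

/-- Diagonal scaling `(x ⊗ y ⊗ z) ⊙ t` is a restriction of `t` (diagonal matrices).
[cite: Blaser2013, Lemma 5.4] -/
theorem tensorRestrictsTo_diagScale (t : ι → κ → μ → K) (x : ι → K) (y : κ → K) (z : μ → K) :
    TensorRestrictsTo t (fun a b c => x a * y b * z c * t a b c) := by
  refine ⟨fun a' a => if a = a' then x a else 0, fun b' b => if b = b' then y b else 0,
    fun c' c => if c = c' then z c else 0, fun a' b' c' => ?_⟩
  rw [Finset.sum_eq_single a' (fun a _ ha => by simp [ha]) (by simp),
    Finset.sum_eq_single b' (fun b _ hb => by simp [hb]) (by simp),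
    Finset.sum_eq_single c' (fun c _ hc => by simp [hc]) (by simp)]
  simp

/-- Hence `R((x ⊗ y ⊗ z) ⊙ t) ≤ R(t)`. [cite: Blaser2013, Lemma 5.4] -/
theorem tensorRank_diagScale_le (t : ι → κ → μ → K) (x : ι → K) (y : κ → K) (z : μ → K) :
    tensorRank (fun a b c => x a * y b * z c * t a b c) ≤ tensorRank t :=
  (tensorRestrictsTo_diagScale t x y z).tensorRank_le

/-- Scaling by nowhere-zero diagonals is invertible, so the rank is unchanged.
[cite: Blaser2013, Lemma 5.4] -/
theorem tensorRank_diagScale_eq (t : ι → κ → μ → K) {x : ι → K} {y : κ → K} {z : μ → K}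
    (hx : ∀ a, x a ≠ 0) (hy : ∀ b, y b ≠ 0) (hz : ∀ c, z c ≠ 0) :
    tensorRank (fun a b c => x a * y b * z c * t a b c) = tensorRank t := by
  refine le_antisymm (tensorRank_diagScale_le t x y z) ?_
  have h : t = fun a b c => (x a)⁻¹ * (y b)⁻¹ * (z c)⁻¹ * (x a * y b * z c * t a b c) := by
    funext a b c
    rw [show (x a)⁻¹ * (y b)⁻¹ * (z c)⁻¹ * (x a * y b * z c * t a b c)
        = ((x a)⁻¹ * x a) * ((y b)⁻¹ * y b) * ((z c)⁻¹ * z c) * t a b c by ring,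
      inv_mul_cancel₀ (hx a), inv_mul_cancel₀ (hy b), inv_mul_cancel₀ (hz c)]
    ring
  conv_lhs => rw [h]
  exact tensorRank_diagScale_le _ _ _ _

end Scale

/-! ## Every tensor with the support of `T_cw,q` is a torus translate of it -/

/-- The support of `T_cw,q`, pointwise. [cite: ConnerGesmundoLandsbergVentura2022, eq. (1)] -/
theorem cwTensor_ne_zero_iff (q : ℕ) (i j k : Fin (q + 1)) :
    cwTensor ℂ q i j k ≠ 0 ↔
      (i = 0 ∧ j = k ∧ j ≠ 0) ∨ (j = 0 ∧ i = k ∧ i ≠ 0) ∨ (k = 0 ∧ i = j ∧ i ≠ 0) := by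
  rw [cwTensor_apply]
  split_ifs with h <;> simp [h]

/-- **Torus normal form.** If `supp T' = supp T_cw,q` then `T' = (x ⊗ y ⊗ z) ⊙ T_cw,q` with
nowhere-zero `x, y, z`: take `x₀ = y₀ = z₀ = 1`, `x_j = (T'_{j0j} T'_{jj0} / T'_{0jj})^{1/2}`,
`y_j = T'_{jj0}/x_j`, `z_j = T'_{j0j}/x_j`. [cite: CohnUmans2013, §3 p. 8] -/
theorem exists_diagScale_of_sameSupport_cwTensor (q : ℕ)
    {T' : Fin (q + 1) → Fin (q + 1) → Fin (q + 1) → ℂ} (h : SameSupport (cwTensor ℂ q) T') :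
    ∃ x y z : Fin (q + 1) → ℂ, (∀ a, x a ≠ 0) ∧ (∀ a, y a ≠ 0) ∧ (∀ a, z a ≠ 0) ∧
      T' = fun a b c => x a * y b * z c * cwTensor ℂ q a b c := by
  -- the three families of support entries, all non-zero
  have hA : ∀ j : Fin (q + 1), j ≠ 0 → T' 0 j j ≠ 0 := fun j hj =>
    (h 0 j j).1 ((cwTensor_ne_zero_iff q 0 j j).2 (Or.inl ⟨rfl, rfl, hj⟩))
  have hB : ∀ j : Fin (q + 1), j ≠ 0 → T' j 0 j ≠ 0 := fun j hj =>
    (h j 0 j).1 ((cwTensor_ne_zero_iff q j 0 j).2 (Or.inr (Or.inl ⟨rfl, rfl, hj⟩)))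
  have hC : ∀ j : Fin (q + 1), j ≠ 0 → T' j j 0 ≠ 0 := fun j hj =>
    (h j j 0).1 ((cwTensor_ne_zero_iff q j j 0).2 (Or.inr (Or.inr ⟨rfl, rfl, hj⟩)))
  have hoff : ∀ i j k, cwTensor ℂ q i j k = 0 → T' i j k = 0 := fun i j k h0 => by
    by_contra h1
    exact ((h i j k).2 h1) h0
  -- the square root
  let s : Fin (q + 1) → ℂ := fun j =>
    if j = 0 then 1 else (T' j 0 j * T' j j 0 / T' 0 j j) ^ ((2 : ℕ) : ℂ)⁻¹
  have hs0 : s 0 = 1 := by simp [s]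
  have hs2 : ∀ j, j ≠ 0 → s j ^ 2 = T' j 0 j * T' j j 0 / T' 0 j j := fun j hj => by
    simp only [s, hj, if_false]
    exact Complex.cpow_nat_inv_pow _ two_ne_zero
  have hsne : ∀ j, s j ≠ 0 := fun j => by
    by_cases hj : j = 0
    · simp [s, hj]
    · intro h0
      have := hs2 j hj
      rw [h0, zero_pow two_ne_zero] at this
      exact div_ne_zero (mul_ne_zero (hB j hj) (hC j hj)) (hA j hj) this.symm
  refine ⟨s, fun j => if j = 0 then 1 else T' j j 0 / s j,
    fun j => if j = 0 then 1 else T' j 0 j / s j, hsne, fun j => ?_, fun j => ?_, ?_⟩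
  · by_cases hj : j = 0
    · simp [hj]
    · simpa [hj] using div_ne_zero (hC j hj) (hsne j)
  · by_cases hj : j = 0
    · simp [hj]
    · simpa [hj] using div_ne_zero (hB j hj) (hsne j)
  funext a b c
  by_cases hcw : cwTensor ℂ q a b c = 0
  · rw [hoff a b c hcw, hcw, mul_zero]
  rcases (cwTensor_ne_zero_iff q a b c).1 hcw with ⟨rfl, rfl, hb⟩ | ⟨rfl, rfl, ha⟩ | ⟨rfl, rfl, ha⟩
  · -- `(0, j, j)`: `1 · (T'_{jj0}/s_j) · (T'_{j0j}/s_j) = T'_{0jj}`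
    have hv : cwTensor ℂ q 0 b b = 1 := by simp [cwTensor_apply, hb]
    rw [hv, hs0]
    simp only [hb, if_false, mul_one, one_mul]
    rw [div_mul_div_comm, ← sq, hs2 b hb, div_div_eq_mul_div, mul_comm (T' b b 0) (T' b 0 b),
      mul_div_cancel_left₀ _ (mul_ne_zero (hB b hb) (hC b hb))]
  · -- `(j, 0, j)`: `s_j · 1 · (T'_{j0j}/s_j) = T'_{j0j}`
    have hv : cwTensor ℂ q a 0 a = 1 := by simp [cwTensor_apply, ha]
    rw [hv]
    simp only [ha, if_false, if_true, mul_one]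
    rw [← mul_div_assoc, mul_div_cancel_left₀ _ (hsne a)]
  · -- `(j, j, 0)`: `s_j · (T'_{jj0}/s_j) · 1 = T'_{jj0}`
    have hv : cwTensor ℂ q a a 0 = 1 := by simp [cwTensor_apply, ha]
    rw [hv]
    simp only [ha, if_false, if_true, mul_one]
    rw [← mul_div_assoc, mul_div_cancel_left₀ _ (hsne a)]

/-- Hence every tensor with the support of `T_cw,q` has the rank of `T_cw,q`.
[cite: CohnUmans2013, §3 p. 8] -/
theorem tensorRank_eq_of_sameSupport_cwTensor (q : ℕ)
    {T' : Fin (q + 1) → Fin (q + 1) → Fin (q + 1) → ℂ} (h : SameSupport (cwTensor ℂ q) T') :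
    tensorRank T' = tensorRank (cwTensor ℂ q) := by
  obtain ⟨x, y, z, hx, hy, hz, rfl⟩ := exists_diagScale_of_sameSupport_cwTensor q h
  exact tensorRank_diagScale_eq _ hx hy hz

/-- **No gain at level one:** `R_s(T_cw,q) = R(T_cw,q)`. [cite: CohnUmans2013, §3 p. 8] -/
theorem supportRank_cwTensor (q : ℕ) : supportRank (cwTensor ℂ q) = tensorRank (cwTensor ℂ q) := by
  refine le_antisymm (supportRank_le_tensorRank _) ?_
  unfold supportRank
  refine le_csInf ⟨_, cwTensor ℂ q, SameSupport.refl _, rfl⟩ ?_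
  rintro _ ⟨t, ht, rfl⟩
  exact (tensorRank_eq_of_sameSupport_cwTensor q ht).ge

/-- In particular `R_s(T_cw,2) = 4`: the s-rank door has no width at level `N = 1`; its
re-weightings acquire moduli only from `N = 2` on. [cite: CohnUmans2013, §3 p. 8] -/
theorem supportRank_cwTensor_two : supportRank (cwTensor ℂ 2) = 4 := by
  rw [supportRank_cwTensor, CarrierFamily.tensorRank_cwTensor_two]

end Summit.MatrixMultiplication.MatrixMultiplication.Theorems.SupportRankDoor

end
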